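import Summits.CriticalPhenomena.SAWScalingLimit.Theorems.BoundaryClosureNegative_ConformalMap

/-!
# Negative knowledge on crux `BoundaryClosure` — the corridor refutation of `HexObservableLimit`, part 3: boundary behaviour of `Φ_r`, a continuous logarithm `L_r` of `Φ_r'`, the test-function lemma, and the endgame (two normalisations `r = p, q` are incompatible).

Support for `SAWDefectDecoherenceHexObservableLimitRefutation.lean` (item stmt-CriticalPhenomena-5420, the conclusion of
crux `BoundaryClosure`, stmt-CriticalPhenomena-8536). Everything proved. [folklore]
-/

noncomputable section

open Set Filter Topology Complex
open Literature.Probability.RandomPlanarGeometry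
open UpperHalfPlane (upperHalfPlaneSet)

namespace Summit.CriticalPhenomena.SAWScalingLimit.Theorems.BoundaryClosure.Negative

/-! ### Boundary behaviour and the logarithm of the derivative -/

/-- **`Φ_r → ∞` at `r`.** [folklore] -/
theorem tendsto_norm_PhiCE {r : ℝ} (hr : 0 < r ∧ r < 1) :
    Tendsto (fun x => ‖PhiCE r hr x‖) (𝓝[HD] (r : ℂ)) atTop := by
  have hev : (fun x => (1 - r) ^ 2 * ‖x‖ / ‖1 - (r : ℂ) * x‖ * ‖x - r‖⁻¹) =ᶠ[𝓝[HD] (r : ℂ)]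
      fun x => ‖PhiCE r hr x‖ := by
    refine eventually_nhdsWithin_of_forall fun x hx => ?_
    show (1 - r) ^ 2 * ‖x‖ / ‖1 - (r : ℂ) * x‖ * ‖x - r‖⁻¹ = ‖PhiCE r hr x‖
    rw [PhiCE_apply hr hx, phiR, norm_div, norm_mul, norm_mul, ← norm_neg ((r : ℂ) - x), neg_sub,
      norm_pow]
    have e : ‖(1 : ℂ) - r‖ = 1 - r := by
      rw [show (1 : ℂ) - r = ((1 - r : ℝ) : ℂ) by push_cast; ring, Complex.norm_real,
        Real.norm_of_nonneg (by linarith [hr.2])]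
    rw [e]
    field_simp
  refine Tendsto.congr' hev ?_
  have hC : 0 < (1 - r) ^ 2 * ‖(r : ℂ)‖ / ‖1 - (r : ℂ) * r‖ := by
    rw [Complex.norm_real, Real.norm_of_nonneg hr.1.le]
    have : ‖(1 : ℂ) - r * r‖ = 1 - r * r := by
      rw [show (1 : ℂ) - r * r = ((1 - r * r : ℝ) : ℂ) by push_cast; ring, Complex.norm_real,
        Real.norm_of_nonneg (by nlinarith [hr.1, hr.2])]
    rw [this]
    exact div_pos (mul_pos (pow_pos (by linarith [hr.2]) 2) hr.1) (by nlinarith [hr.1, hr.2])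
  refine Tendsto.pos_mul_atTop hC ?_ ?_
  · -- the regular factor is continuous at `r`
    have hcont : ContinuousAt (fun x : ℂ => (1 - r) ^ 2 * ‖x‖ / ‖1 - (r : ℂ) * x‖) r := by
      refine ContinuousAt.div (by fun_prop) (by fun_prop) ?_
      rw [show (1 : ℂ) - r * r = ((1 - r * r : ℝ) : ℂ) by push_cast; ring, Complex.norm_real,
        Real.norm_of_nonneg (by nlinarith [hr.1, hr.2])]
      nlinarith [hr.1, hr.2]
    exact hcont.tendsto.mono_left nhdsWithin_le_nhds
  · -- `‖x - r‖⁻¹ → ∞`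
    refine tendsto_inv_nhdsGT_zero.comp ?_
    rw [tendsto_nhdsWithin_iff]
    constructor
    · have : ContinuousAt (fun x : ℂ => ‖x - r‖) r := by fun_prop
      have h := this.tendsto
      rw [sub_self, norm_zero] at h
      exact h.mono_left nhdsWithin_le_nhds
    · refine eventually_nhdsWithin_of_forall fun x hx => ?_
      rw [mem_Ioi, norm_pos_iff, sub_ne_zero]
      rintro rfl
      simp [HD] at hx

/-- **`Φ_r → 0` at `0`.** [folklore] -/
theorem tendsto_PhiCE_zero {r : ℝ} (hr : 0 < r ∧ r < 1) :
    (PhiCE r hr).HasBoundaryValue 0 0 := by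
  unfold ConformalEquiv.HasBoundaryValue
  have hev : phiR r =ᶠ[𝓝[HD] (0 : ℂ)] fun x => PhiCE r hr x :=
    eventually_nhdsWithin_of_forall fun x hx => (PhiCE_apply hr hx).symm
  refine Tendsto.congr' hev ?_
  have hcont : ContinuousAt (phiR r) 0 := by
    unfold phiR
    refine ContinuousAt.div (by fun_prop) (by fun_prop) ?_
    simp [hr.1.ne']
  have h := hcont.tendsto
  rw [show phiR r 0 = 0 by simp [phiR]] at h
  exact h.mono_left nhdsWithin_le_nhds

/-- **The derivative of `Φ_r`**: `Φ_r'(z) = (1-r)² r (1-z²) / ((r-z)(1-rz))²`. [folklore] -/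
def dphiR (r : ℝ) (z : ℂ) : ℂ := (1 - r) ^ 2 * r * (1 - z ^ 2) / ((r - z) * (1 - r * z)) ^ 2

/-- `phiR r` has derivative `dphiR r` away from the poles. [folklore] -/
theorem hasDerivAt_phiR {r : ℝ} {z : ℂ} (h3 : (r : ℂ) - z ≠ 0) (h4 : (1 : ℂ) - r * z ≠ 0) :
    HasDerivAt (phiR r) (dphiR r z) z := by
  have hc : HasDerivAt (fun y : ℂ => ((1 - r) ^ 2 : ℂ) * y) ((1 - r) ^ 2 * 1) z :=
    (hasDerivAt_id z).const_mul _
  have hd : HasDerivAt (fun y : ℂ => ((r : ℂ) - y) * (1 - r * y))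
      ((0 - 1) * (1 - r * z) + ((r : ℂ) - z) * (0 - r * 1)) z :=
    ((hasDerivAt_const z (r : ℂ)).sub (hasDerivAt_id z)).mul
      ((hasDerivAt_const z (1 : ℂ)).sub ((hasDerivAt_id z).const_mul (r : ℂ)))
  have h := hc.div hd (mul_ne_zero h3 h4)
  have e : ((1 - ↑r) ^ 2 * 1 * ((↑r - z) * (1 - ↑r * z)) -
      (1 - ↑r) ^ 2 * z * ((0 - 1) * (1 - ↑r * z) + (↑r - z) * (0 - ↑r * 1))) /
      ((↑r - z) * (1 - ↑r * z)) ^ 2 = dphiR r z := by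
    unfold dphiR; congr 1; ring
  rw [e] at h
  exact h

/-- The derivative of the conformal map on the half-disc. [folklore] -/
theorem deriv_PhiCE {r : ℝ} (hr : 0 < r ∧ r < 1) {z : ℂ} (hz : z ∈ HD) :
    deriv (PhiCE r hr) z = dphiR r z := by
  have hev : (fun x => PhiCE r hr x) =ᶠ[𝓝 z] phiR r := by
    filter_upwards [isOpen_HD.mem_nhds hz] with x hx using PhiCE_apply hr hx
  rw [hev.deriv_eq]
  obtain ⟨h3, h4⟩ := denom_ne_zero hr hz.2
  exact (hasDerivAt_phiR h3 h4).deriv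

/-- **A logarithm of `Φ_r'`**: `L_r(z) = log((1-r)² r) + Log(1-z²) - 2 Log(r-z) - 2 Log(1-rz)`. [folklore] -/
def Lfun (r : ℝ) (z : ℂ) : ℂ :=
  Complex.log (((1 - r) ^ 2 * r : ℝ) : ℂ) + Complex.log (1 - z ^ 2) - 2 * Complex.log (r - z) -
    2 * Complex.log (1 - r * z)

/-- Continuity of `L_r` at points where the three arguments avoid the negative real axis. [folklore] -/
theorem continuousAt_Lfun {r : ℝ} {z : ℂ} (h1 : 1 - z ^ 2 ∈ Complex.slitPlane)
    (h2 : (r : ℂ) - z ∈ Complex.slitPlane) (h3 : 1 - (r : ℂ) * z ∈ Complex.slitPlane) :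
    ContinuousAt (Lfun r) z := by
  unfold Lfun
  refine ((continuousAt_const.add ?_).sub ?_).sub ?_
  · exact ContinuousAt.clog (by fun_prop) h1
  · exact continuousAt_const.mul (ContinuousAt.clog (by fun_prop) h2)
  · exact continuousAt_const.mul (ContinuousAt.clog (by fun_prop) h3)

/-- The three arguments avoid the negative real axis on the half-disc. [folklore] -/
theorem slit_of_mem_HD {r : ℝ} (hr : 0 < r ∧ r < 1) {z : ℂ} (hz : z ∈ HD) :
    1 - z ^ 2 ∈ Complex.slitPlane ∧ (r : ℂ) - z ∈ Complex.slitPlane ∧ 1 - (r : ℂ) * z ∈ Complex.slitPlane := by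
  obtain ⟨hz1, hz2⟩ := hz
  refine ⟨?_, ?_, ?_⟩
  · rw [Complex.mem_slitPlane_iff]
    by_cases hx : z.re = 0
    · left
      simp only [Complex.sub_re, Complex.one_re, pow_two, Complex.mul_re, hx, zero_mul, zero_sub]
      nlinarith
    · right
      simp only [Complex.sub_im, Complex.one_im, pow_two, Complex.mul_im, zero_sub, ne_eq, neg_eq_zero]
      have : z.re * z.im + z.im * z.re = 2 * (z.re * z.im) := by ring
      rw [this]
      exact mul_ne_zero two_ne_zero (mul_ne_zero hx hz2.ne')
  · rw [Complex.mem_slitPlane_iff]; right; simp; exact hz2.ne'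
  · rw [Complex.mem_slitPlane_iff]; right; simp; exact ⟨hr.1.ne', hz2.ne'⟩

/-- The three arguments avoid the negative real axis at `0`. [folklore] -/
theorem slit_zero {r : ℝ} (hr : 0 < r ∧ r < 1) :
    1 - (0 : ℂ) ^ 2 ∈ Complex.slitPlane ∧ (r : ℂ) - 0 ∈ Complex.slitPlane ∧
      1 - (r : ℂ) * 0 ∈ Complex.slitPlane := by
  refine ⟨by simp, ?_, by simp⟩
  rw [sub_zero, Complex.ofReal_mem_slitPlane]; exact hr.1

/-- **`L_r` is continuous on the half-disc.** [folklore] -/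
theorem continuousOn_Lfun {r : ℝ} (hr : 0 < r ∧ r < 1) : ContinuousOn (Lfun r) HD := fun _ hz =>
  (continuousAt_Lfun (slit_of_mem_HD hr hz).1 (slit_of_mem_HD hr hz).2.1
    (slit_of_mem_HD hr hz).2.2).continuousWithinAt

/-- **`L_r` has the boundary value `L_r 0` at `0`.** [folklore] -/
theorem tendsto_Lfun_zero {r : ℝ} (hr : 0 < r ∧ r < 1) :
    Tendsto (Lfun r) (𝓝[HD] (0 : ℂ)) (𝓝 (Lfun r 0)) :=
  (continuousAt_Lfun (slit_zero hr).1 (slit_zero hr).2.1 (slit_zero hr).2.2).tendsto.mono_left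
    nhdsWithin_le_nhds

/-- **`exp L_r = Φ_r'` on the half-disc.** [folklore] -/
theorem exp_Lfun {r : ℝ} (hr : 0 < r ∧ r < 1) {z : ℂ} (hz : z ∈ HD) :
    Complex.exp (Lfun r z) = deriv (PhiCE r hr) z := by
  rw [deriv_PhiCE hr hz, dphiR, Lfun]
  obtain ⟨h3, h4⟩ := denom_ne_zero hr hz.2
  have h1 : (1 : ℂ) - z ^ 2 ≠ 0 := Complex.slitPlane_ne_zero (slit_of_mem_HD hr hz).1
  have h0 : (((1 - r) ^ 2 * r : ℝ) : ℂ) ≠ 0 := by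
    norm_cast; exact mul_ne_zero (pow_ne_zero 2 (by linarith [hr.2])) hr.1.ne'
  rw [Complex.exp_sub, Complex.exp_sub, Complex.exp_add, Complex.exp_log h0, Complex.exp_log h1,
    show (2 : ℂ) * Complex.log (r - z) = ((2 : ℕ) : ℂ) * Complex.log (r - z) by norm_num,
    show (2 : ℂ) * Complex.log (1 - r * z) = ((2 : ℕ) : ℂ) * Complex.log (1 - r * z) by norm_num,
    Complex.exp_nat_mul, Complex.exp_nat_mul, Complex.exp_log h3, Complex.exp_log h4]
  push_cast
  field_simp


/-! ### Test functions detect continuous functions -/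

/-- A continuous compactly supported cut-off times a function continuous on an open set containing
the support is continuous. [folklore] -/
theorem continuous_mul_of_tsupport_subset {U : Set ℂ} (hU : IsOpen U) {ψ g : ℂ → ℂ}
    (hψ : Continuous ψ) (hsupp : tsupport ψ ⊆ U) (hg : ContinuousOn g U) :
    Continuous fun z => ψ z * g z := by
  rw [continuous_iff_continuousAt]
  intro z
  by_cases hz : z ∈ U
  · exact hψ.continuousAt.mul (hg.continuousAt (hU.mem_nhds hz))
  · have hz' : z ∉ tsupport ψ := fun h => hz (hsupp h)
    rw [notMem_tsupport_iff_eventuallyEq] at hz'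
    have : (fun z => ψ z * g z) =ᶠ[𝓝 z] fun _ => 0 := by
      filter_upwards [hz'] with x hx
      simp [hx]
    exact (continuousAt_const.congr this.symm)

/-- **A function continuous on an open set, orthogonal to all test functions supported in the set,
vanishes there.** [folklore] -/
theorem eq_zero_of_forall_integral {U : Set ℂ} (hU : IsOpen U) {G : ℂ → ℂ} (hG : ContinuousOn G U)
    (h : ∀ ψ : ℂ → ℂ, Continuous ψ → HasCompactSupport ψ → tsupport ψ ⊆ U → ∫ z, ψ z * G z = 0)
    {z₀ : ℂ} (hz₀ : z₀ ∈ U) : G z₀ = 0 := by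
  by_contra hne
  set a : ℂ := G z₀ with ha
  have ha0 : 0 < ‖a‖ := norm_pos_iff.2 hne
  -- a radius with `closedBall z₀ ε ⊆ U` and `‖G z - a‖ < ‖a‖/2` on the ball
  obtain ⟨ε₁, hε₁, hball⟩ := Metric.mem_nhds_iff.1 (hU.mem_nhds hz₀)
  have hcont : ContinuousAt G z₀ := hG.continuousAt (hU.mem_nhds hz₀)
  obtain ⟨ε₂, hε₂, hclose⟩ := Metric.continuousAt_iff.1 hcont (‖a‖ / 2) (by positivity)
  set ε : ℝ := min (ε₁ / 2) ε₂ with hε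
  have hε0 : 0 < ε := lt_min (by positivity) hε₂
  have hεU : Metric.closedBall z₀ ε ⊆ U := fun z hz => hball (by
    rw [Metric.mem_closedBall] at hz; rw [Metric.mem_ball]
    exact lt_of_le_of_lt hz (lt_of_le_of_lt (min_le_left _ _) (by linarith)))
  have hG' : ∀ z, dist z z₀ < ε → ‖G z - a‖ < ‖a‖ / 2 := fun z hz => by
    rw [← dist_eq_norm]; exact hclose (lt_of_lt_of_le hz (min_le_right _ _))
  -- the bump
  set χ : ℂ → ℝ := fun z => max 0 (ε / 2 - ‖z - z₀‖) with hχ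
  have hχc : Continuous χ := by
    rw [hχ]; fun_prop
  have hχ0 : ∀ z, 0 ≤ χ z := fun z => le_max_left _ _
  have hχsupp : ∀ z, χ z ≠ 0 → dist z z₀ < ε / 2 := by
    intro z hz
    rw [dist_eq_norm]
    by_contra hc
    push Not at hc
    exact hz (max_eq_left (by linarith))
  have hχK : HasCompactSupport χ := by
    refine HasCompactSupport.intro (isCompact_closedBall z₀ (ε / 2)) fun z hz => ?_
    by_contra hne'
    exact hz (Metric.mem_closedBall.2 (hχsupp z hne').le)
  have hχts : tsupport χ ⊆ U := by
    refine (closure_minimal ?_ Metric.isClosed_closedBall).trans ((Metric.closedBall_subset_closedBall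
      (by linarith : ε / 2 ≤ ε)).trans hεU)
    intro z hz
    exact Metric.mem_closedBall.2 (hχsupp z hz).le
  -- the test function `ψ = χ · conj a`
  set ψ : ℂ → ℂ := fun z => (χ z : ℂ) * (starRingEnd ℂ) a with hψ
  have hψc : Continuous ψ := by rw [hψ]; fun_prop
  have hψK : HasCompactSupport ψ := by
    rw [hψ]
    exact (hχK.comp_left (g := fun x : ℝ => (x : ℂ)) Complex.ofReal_zero).mul_right
  have hψts : tsupport ψ ⊆ U := by
    refine (tsupport_mul_subset_left).trans ?_
    have : tsupport (fun z => ((χ z : ℝ) : ℂ)) ⊆ tsupport χ := by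
      apply closure_mono
      intro z hz h0
      exact hz (by simp [h0])
    exact this.trans hχts
  have hint := h ψ hψc hψK hψts
  -- the real part of the integrand is nonnegative, continuous, compactly supported, positive at z₀
  set F : ℂ → ℂ := fun z => ψ z * G z with hF
  have hFc : Continuous F := continuous_mul_of_tsupport_subset hU hψc hψts hG
  have hFK : HasCompactSupport F := hψK.mul_right
  have hre : ∀ z, (F z).re = χ z * (a.re * (G z).re + a.im * (G z).im) := by
    intro z
    simp only [hF, hψ, Complex.mul_re, Complex.mul_im, Complex.ofReal_re, Complex.ofReal_im,
      Complex.conj_re, Complex.conj_im, zero_mul, sub_zero, add_zero]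
    ring
  have hnn : ∀ z, 0 ≤ (F z).re := by
    intro z
    rw [hre]
    by_cases hz : χ z = 0
    · rw [hz, zero_mul]
    · refine mul_nonneg (hχ0 z) ?_
      have hd := hG' z (lt_of_lt_of_le (hχsupp z hz) (by linarith))
      -- `re(conj a · G z) = ‖a‖² + re(conj a (G z - a)) ≥ ‖a‖² - ‖a‖ ‖G z - a‖ > 0`
      have e : a.re * (G z).re + a.im * (G z).im =
          ‖a‖ ^ 2 + ((starRingEnd ℂ) a * (G z - a)).re := by
        rw [Complex.sq_norm, Complex.normSq_apply]
        simp only [Complex.mul_re, Complex.sub_re, Complex.sub_im, Complex.conj_re, Complex.conj_im]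
        ring
      have hb : |((starRingEnd ℂ) a * (G z - a)).re| ≤ ‖a‖ * ‖G z - a‖ := by
        refine (Complex.abs_re_le_norm _).trans ?_
        rw [norm_mul, Complex.norm_conj]
      rw [e]
      have := neg_abs_le ((starRingEnd ℂ) a * (G z - a)).re
      nlinarith
  have hpos : (F z₀).re ≠ 0 := by
    rw [hre]
    have hχz₀ : χ z₀ = ε / 2 := by
      simp only [hχ, sub_self, norm_zero, sub_zero]
      exact max_eq_right (by linarith)
    rw [hχz₀, ← ha]
    have : a.re * a.re + a.im * a.im = ‖a‖ ^ 2 := by rw [Complex.sq_norm, Complex.normSq_apply]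
    rw [this]
    positivity
  have hposint : 0 < ∫ z, (F z).re :=
    (Complex.continuous_re.comp hFc).integral_pos_of_hasCompactSupport_nonneg_nonzero
      (hFK.comp_left Complex.zero_re) hnn hpos
  have hzero : ∫ z, (F z).re = 0 := by
    have hi : MeasureTheory.Integrable F := hFc.integrable_of_hasCompactSupport hFK
    have := integral_re hi
    simp only [RCLike.re_to_complex] at this
    rw [this, hF]
    simp only
    rw [hint, Complex.zero_re]
  linarith

/-! ### The endgame: the two normalisations are incompatible -/

/-- **Incompatibility of the two predicted limits**: if `exp((5/8)(L_q - L_q 0)) = exp((5/8)(L_p - L_p 0))`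
on the half-disc for `p ≠ q` in `(0,1)`, contradiction. [folklore] -/
theorem endgame {p q : ℝ} (hp : 0 < p ∧ p < 1) (hq : 0 < q ∧ q < 1) (hpq : p ≠ q)
    (h : ∀ z ∈ HD, Complex.exp ((5 / 8 : ℂ) * (Lfun q z - Lfun q 0)) =
      Complex.exp ((5 / 8 : ℂ) * (Lfun p z - Lfun p 0))) : False := by
  set hf : ℂ → ℂ := fun z => (5 / 8 : ℂ) * ((Lfun q z - Lfun q 0) - (Lfun p z - Lfun p 0)) with hhf
  -- values in `2πiℤ`
  have hint : ∀ z ∈ HD, ∃ n : ℤ, hf z = n * (2 * Real.pi * Complex.I) := by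
    intro z hz
    apply Complex.exp_eq_one_iff.1
    rw [hhf]
    simp only
    rw [mul_sub, Complex.exp_sub, h z hz, div_self (Complex.exp_ne_zero _)]
  -- `hf → 0` at `0` within the half-disc
  have hcq := continuousAt_Lfun (slit_zero hq).1 (slit_zero hq).2.1 (slit_zero hq).2.2
  have hcp := continuousAt_Lfun (slit_zero hp).1 (slit_zero hp).2.1 (slit_zero hp).2.2
  have htend : Tendsto hf (𝓝[HD] 0) (𝓝 0) := by
    have hc : ContinuousAt hf 0 := by
      rw [hhf]
      exact continuousAt_const.mul ((hcq.sub continuousAt_const).sub (hcp.sub continuousAt_const))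
    have := hc.tendsto
    rw [show hf 0 = 0 by simp [hhf]] at this
    exact this.mono_left nhdsWithin_le_nhds
  -- hence `hf = 0` near `0` in the half-disc
  have hev : ∀ᶠ z in 𝓝[HD] (0 : ℂ), z ∈ HD ∧ hf z = 0 := by
    have h1 : ∀ᶠ z in 𝓝[HD] (0 : ℂ), ‖hf z‖ < 1 := by
      have := (Metric.tendsto_nhds.1 htend) 1 one_pos
      refine this.mono fun z hz => ?_
      rwa [dist_zero_right] at hz
    filter_upwards [h1, eventually_mem_nhdsWithin] with z hz hzD
    refine ⟨hzD, ?_⟩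
    obtain ⟨n, hn⟩ := hint z hzD
    rw [hn] at hz ⊢
    have hnorm : ‖(n : ℂ) * (2 * Real.pi * Complex.I)‖ = |(n : ℝ)| * (2 * Real.pi) := by
      rw [norm_mul, Complex.norm_intCast, norm_mul, Complex.norm_I, mul_one, norm_mul,
        Complex.norm_real, Real.norm_of_nonneg Real.pi_pos.le, Complex.norm_two]
    rw [hnorm] at hz
    have hn0 : n = 0 := by
      by_contra hne
      have : (1 : ℝ) ≤ |(n : ℝ)| := by
        rw [← Int.cast_abs]; exact_mod_cast Int.one_le_abs hne
      nlinarith [Real.pi_gt_three]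
    rw [hn0]; simp
  -- a point of the half-disc where `hf` vanishes
  have hne : (𝓝[HD] (0 : ℂ)).NeBot := by
    rw [← mem_closure_iff_nhdsWithin_neBot, closure_HD]
    simp
  obtain ⟨z, hzD, hz0⟩ := hev.exists
  -- unfold: `log(p-z) + log(1-pz) - log p = log(q-z) + log(1-qz) - log q`
  have hzim := hzD.2
  obtain ⟨hp3, hp4⟩ := denom_ne_zero hp hzim
  obtain ⟨hq3, hq4⟩ := denom_ne_zero hq hzim
  have hp0 : (p : ℂ) ≠ 0 := by exact_mod_cast hp.1.ne'
  have hq0 : (q : ℂ) ≠ 0 := by exact_mod_cast hq.1.ne'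
  have key : Complex.log (p - z) + Complex.log (1 - p * z) - Complex.log p =
      Complex.log (q - z) + Complex.log (1 - q * z) - Complex.log q := by
    have h58 : (5 / 8 : ℂ) ≠ 0 := by norm_num
    have hA : (Lfun q z - Lfun q 0) - (Lfun p z - Lfun p 0) = 0 := by
      have := hz0; rw [hhf] at this; simpa [h58] using this
    unfold Lfun at hA
    simp only [sub_zero, mul_zero, ne_eq, OfNat.ofNat_ne_zero, not_false_eq_true, zero_pow,
      Complex.log_one] at hA
    linear_combination (1 / 2 : ℂ) * hA
  have key2 : ((p : ℂ) - z) * (1 - p * z) / p = ((q : ℂ) - z) * (1 - q * z) / q := by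
    have e : ∀ (r : ℝ), (r : ℂ) ≠ 0 → (r : ℂ) - z ≠ 0 → (1 : ℂ) - r * z ≠ 0 →
        Complex.exp (Complex.log (r - z) + Complex.log (1 - r * z) - Complex.log r) =
          ((r : ℂ) - z) * (1 - r * z) / r := by
      intro r h0 h3 h4
      rw [Complex.exp_sub, Complex.exp_add, Complex.exp_log h3, Complex.exp_log h4, Complex.exp_log h0]
    rw [← e p hp0 hp3 hp4, ← e q hq0 hq3 hq4, key]
  rw [div_eq_div_iff hp0 hq0] at key2
  have hz : z * ((p : ℂ) - q) * (1 - p * q) = 0 := by linear_combination key2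
  rcases mul_eq_zero.1 hz with h1 | h1
  · rcases mul_eq_zero.1 h1 with h2 | h2
    · rw [h2] at hzim; simp at hzim
    · apply hpq; exact_mod_cast sub_eq_zero.1 h2
  · have : (1 : ℝ) - p * q = 0 := by exact_mod_cast h1
    nlinarith [hp.1, hp.2, hq.1, hq.2]



end Summit.CriticalPhenomena.SAWScalingLimit.Theorems.BoundaryClosure.Negative
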